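import Summits.Parity.GeneralizedHardyLittlewood.Theorems.LeeYangFibresAbsoluteUpgradeUniformResidualDefs
import Summits.Parity.GeneralizedHardyLittlewood.Theorems.LeeYangFibresAbsoluteUpgradeUniformGrowth
import Summits.Parity.GeneralizedHardyLittlewood.Theorems.LeeYangFibresAbsoluteUpgradeUniformAmplificationAux
import Summits.Parity.GeneralizedHardyLittlewood.Theorems.LeeYangFibresRelativeDimOneAmplificationAux
import Summits.Parity.GeneralizedHardyLittlewood.Theorems.LeeYangFibresRelativeDimOneTightness
import Summits.Parity.GeneralizedHardyLittlewood.Theorems.LeeYangFibresRelativeDimOne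
import Summits.Parity.GeneralizedHardyLittlewood.Theorems.LeeYangFibresAbsoluteUpgradeSingularProductLogLog
import Summits.Parity.GeneralizedHardyLittlewood.Theorems.LeeYangFibresAbsoluteUpgradeSlices
import Summits.Parity.GeneralizedHardyLittlewood.Theorems.LeeYangFibresCellParityLawSingularRatio
import HarnessLib

/-!
# Route `LeeYangFibres`, crux `AbsoluteUpgrade` (stmt-Parity-14116), line `Sketch` (uniform amplification):
# the transfer with `RelativeDimOne` LOAD-BEARING (stub F″ `stub_amplificationHighMass`)

`AmplificationHighMass := UniformSingularMean → CollisionFormFacts → RelativeDimOne → HighMassTranslateRelativeDimOne → DimOne`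
(vocabulary `Theorems/LeeYangFibresAbsoluteUpgradeUniformResidualDefs.lean`, appended part).  The landed transfers
`stub_amplification` (p143322) / `stub_amplificationFromTranslates` (p146913) use relative Hardy–Littlewood for the BASE
system `Ψ` on `K` only at LOW singular mass `β_∞𝔖 < 5N`, where relative accuracy `ε₁(β_∞𝔖 + N) ≤ 6ε₁N` is already
absolute — and that is exactly the crux's own hypothesis `RelativeDimOne`.  At HIGH mass `β_∞𝔖 ≥ 5N` only the
translate-constellations `Ψ^{(H)}` with `m = ⌊(log log N)^{t-1}⌋ ≥ 1` translates are needed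
(`HighMassTranslateRelativeDimOne`).  So the same proof runs with `RelativeDimOne` carrying the low-mass sector (twin
primes live there) and the residual carrying the high-mass sector: in the skeleton,
`AbsoluteUpgrade_of hR := stub_amplificationHighMass uniformSingularMean C hR stub_highMassTranslateRelativeDimOne` — the
crux hypothesis is no longer inert, and the residual is not known to contain the target.

References: B. Green, T. Tao, Ann. of Math. 171 (2010), Conj. 1.2 / Conj. 1.4 and Lemma 1.3 [GreenTao2010];
P. X. Gallagher, Mathematika 23 (1976), §2 [Gallagher1976]; T. Tao, V. Vu, *Additive Combinatorics*, §2.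
-/

noncomputable section

open scoped BigOperators Classical Topology
open Finset Filter MeasureTheory Literature.NumberTheory.Sieve
open Summit.Parity.GeneralizedHardyLittlewood.Cruxes.RelativeDimOne.TranslateAmplification

namespace Summit.Parity.GeneralizedHardyLittlewood.Cruxes.AbsoluteUpgrade.UniformAmplification

/-- **THE TRANSFER WITH `RelativeDimOne` LOAD-BEARING** (registered stub `stub_amplificationHighMass` of line `Sketch`,
stub F″): m-uniform Gallagher averaging + the explicit degenerate count + the crux hypothesis `RelativeDimOne` (low mass)
+ relative Hardy–Littlewood for the translate-constellations of high-mass base instances, uniform in the number of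
translates (high mass), give ABSOLUTE Dickson–Hardy–Littlewood `DimOne`. [cite: GreenTao2010, Conj. 1.2 and Conj. 1.4] -/
theorem stub_amplificationHighMass : AmplificationHighMass := by
  unfold AmplificationHighMass
  intro hUSM hCF hR hS t L ht ε hε
  -- `e = min ε 1`
  obtain ⟨e, he⟩ : ∃ e : ℝ, e = min ε 1 := ⟨_, rfl⟩
  have he0 : 0 < e := by rw [he]; exact lt_min hε one_pos
  have he1 : e ≤ 1 := by rw [he]; exact min_le_right _ _
  have heε : e ≤ ε := by rw [he]; exact min_le_left _ _
  -- the singular-mass constant (S1) and `ε₁`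
  obtain ⟨C, hC0, N₁, hS1⟩ := Theorems.AbsoluteUpgrade.stub_singularProduct_le_loglog_pow t L ht
  obtain ⟨ε₁, hε₁⟩ : ∃ ε₁ : ℝ, ε₁ = e / (100 * (C + 1)) := ⟨_, rfl⟩
  have hε₁0 : 0 < ε₁ := by rw [hε₁]; positivity
  have hε₁8 : ε₁ ≤ 1 / 8 := by
    rw [hε₁, div_le_iff₀ (by positivity)]
    linarith
  have h6 : 6 * ε₁ ≤ e := by
    rw [hε₁, mul_div_assoc', div_le_iff₀ (by positivity)]
    nlinarith [mul_nonneg he0.le hC0.le]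
  have h16 : 16 * ε₁ * C ≤ e := by
    have h1 : 16 * ε₁ * C = e * (16 * C / (100 * (C + 1))) := by rw [hε₁]; ring
    have h2 : 16 * C / (100 * (C + 1)) ≤ 1 := by
      rw [div_le_one (by positivity)]
      linarith
    rw [h1]
    exact (mul_le_mul_of_nonneg_left h2 he0.le).trans (le_of_eq (mul_one e))
  -- the hypotheses, instantiated once (before the scale)
  obtain ⟨N₂, hN₂⟩ := hR t L ht ε₁ hε₁0
  obtain ⟨N₃, hN₃⟩ := hS t L t ht ε₁ hε₁0
  obtain ⟨N₄, hN₄⟩ := hUSM t L t ht ε₁ hε₁0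
  -- the scale: `log log N ≥ 2t`, `N ≥ 1`, and the uniform junk inequality
  have hL₁ : (1 : ℝ) ≤ ((max L 1 : ℕ) : ℝ) := by exact_mod_cast le_max_right L 1
  have hLL₁ : (L : ℝ) ≤ ((max L 1 : ℕ) : ℝ) := by exact_mod_cast le_max_left L 1
  obtain ⟨N₅, hN₅⟩ := Filter.eventually_atTop.mp ((eventually_le_loglog (2 * (t : ℝ))).and
    ((eventually_ge_atTop 1).and (eventually_degenerate_junk_le ht hL₁ hε₁0)))
  refine ⟨N₁ + N₂ + N₃ + N₄ + N₅, fun N hN Ψ hΨ hL K hK hKN => ?_⟩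
  have hNN₁ : N₁ ≤ N := by omega
  have hNN₂ : N₂ ≤ N := by omega
  have hNN₃ : N₃ ≤ N := by omega
  have hNN₄ : N₄ ≤ N := by omega
  obtain ⟨hℓ, hN1, hJ⟩ := hN₅ N (by omega)
  have hN0 : (0 : ℝ) ≤ N := Nat.cast_nonneg N
  have hN1r : (1 : ℝ) ≤ N := by exact_mod_cast hN1
  -- the number of translates
  obtain ⟨m, hm1, hmℓ, hT⟩ := exists_translates ht hℓ
  have hm0 : (0 : ℝ) < (m : ℝ) + 1 := by positivity
  -- `S`, `M = β_∞ 𝔖` and the singular mass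
  have hS0 : 0 ≤ vonMangoldtSum Ψ K N :=
    Theorems.LeeYangFibresRelativeDimOne.vonMangoldtSum_nonneg Ψ K N
  have hV0 : 0 ≤ archFactor Ψ K := archFactor_nonneg' Ψ K
  have hV2 : archFactor Ψ K ≤ 2 * (N : ℝ) := Theorems.AbsoluteUpgrade.archFactor_le_two_mul Ψ hKN
  have h𝔖0 : 0 ≤ singularProduct Ψ :=
    CellParityLaw.SectionAnnihilator.SingularRatio.singularProduct_nonneg hΨ
  have h𝔖C : singularProduct Ψ ≤ C * Real.log (Real.log N) ^ (t - 1) := hS1 N hNN₁ Ψ hΨ hL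
  have hM0 : 0 ≤ archFactor Ψ K * singularProduct Ψ := mul_nonneg hV0 h𝔖0
  have hMle : archFactor Ψ K * singularProduct Ψ ≤ 2 * (N : ℝ) * (C * ((m : ℝ) + 1)) :=
    calc archFactor Ψ K * singularProduct Ψ ≤ 2 * (N : ℝ) * (C * Real.log (Real.log N) ^ (t - 1)) :=
          mul_le_mul hV2 h𝔖C h𝔖0 (by positivity)
      _ ≤ 2 * (N : ℝ) * (C * ((m : ℝ) + 1)) :=
          mul_le_mul_of_nonneg_left (mul_le_mul_of_nonneg_left hmℓ.le hC0.le) (by positivity)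
  have heN : e * (N : ℝ) ≤ ε * N := mul_le_mul_of_nonneg_right heε hN0
  rcases lt_or_ge (archFactor Ψ K * singularProduct Ψ) (5 * N) with hlow | hhigh
  · -- LOW MASS: the crux hypothesis `RelativeDimOne` itself (relative error `ε₁(M + N) ≤ 6 ε₁ N` is absolute here)
    have h := hN₂ N hNN₂ Ψ hΨ hL K hK hKN
    calc |vonMangoldtSum Ψ K N - archFactor Ψ K * singularProduct Ψ|
        ≤ ε₁ * (archFactor Ψ K * singularProduct Ψ + N) := h
      _ ≤ ε₁ * (6 * N) := mul_le_mul_of_nonneg_left (by linarith) hε₁0.le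
      _ = 6 * ε₁ * N := by ring
      _ ≤ e * N := mul_le_mul_of_nonneg_right h6 hN0
      _ ≤ ε * N := heN
  · -- HIGH MASS: the tensor-power trick with `m + 1` translates
    have hL'1 : (1 : ℝ) ≤ (3 * (m : ℝ) + 1) * ((max L 1 : ℕ) : ℝ) := by
      have hm0' : (0 : ℝ) ≤ m := Nat.cast_nonneg m
      nlinarith
    have hsize' : ∀ H ∈ shiftBox m N,
        affLinSize (translateFamily Ψ H) N ≤ (3 * m + 1) * ((max L 1 : ℕ) : ℝ) :=
      fun H hH => affLinSize_translateFamily_le hN1 (hL.trans hLL₁) hH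
    have hB0 : 0 ≤ (2 * (N : ℝ) + 1) *
        Real.log (2 * ((3 * (m : ℝ) + 1) * ((max L 1 : ℕ) : ℝ)) * N) ^ ((m + 1) * t) := by
      refine mul_nonneg (by positivity) (pow_nonneg (Real.log_nonneg ?_) _)
      nlinarith
    have key := uniform_high_mass_amplify (shiftBox m N)
      (fun H => IsNondegenerateSystem (translateFamily Ψ H))
      (fun H => vonMangoldtSum (translateFamily Ψ H) (meetTranslates K H) N)
      (fun H => archFactor (translateFamily Ψ H) (meetTranslates K H) *
        singularProduct (translateFamily Ψ H))
      m hε₁0.le hε₁8 hS0 hM0 hhigh (completeSum m t N Ψ K hKN) (hN₄ N hNN₄ m hT Ψ hΨ hL K hK hKN)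
      (fun H hH hnd => hN₃ N hNN₃ m hm1 hT Ψ hΨ hL K hK hKN hhigh H hH hnd)
      (fun H hH _ => vonMangoldtSum_le_card_mul hN1 hL'1 (hsize' H hH) (meetTranslates K H))
      hB0
      (fun H _ => Theorems.LeeYangFibresRelativeDimOne.vonMangoldtSum_nonneg _ _ _)
      (card_shiftBox_real_le m hN1) (hCF.1 m t N Ψ hΨ) (hJ m hT)
    calc |vonMangoldtSum Ψ K N - archFactor Ψ K * singularProduct Ψ|
        ≤ 8 * ε₁ / ((m : ℝ) + 1) * (archFactor Ψ K * singularProduct Ψ) := key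
      _ ≤ 8 * ε₁ / ((m : ℝ) + 1) * (2 * (N : ℝ) * (C * ((m : ℝ) + 1))) :=
          mul_le_mul_of_nonneg_left hMle (by positivity)
      _ = 16 * ε₁ * C * N := by
          rw [div_mul_eq_mul_div, div_eq_iff hm0.ne']
          ring
      _ ≤ e * N := mul_le_mul_of_nonneg_right h16 hN0
      _ ≤ ε * N := heN


/-- **The crux from the high-mass residual**: `RelativeDimOne → DimOne` given `HighMassTranslateRelativeDimOne` (and the two
landed unconditional inputs as hypotheses, to keep this file import-light; the skeleton feeds `uniformSingularMean` and
`collisionFormFacts`). [cite: GreenTao2010, Conj. 1.2 and Conj. 1.4] -/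
theorem absoluteUpgrade_of_highMassTranslate (hUSM : UniformSingularMean) (hCF : CollisionFormFacts)
    (hH : HighMassTranslateRelativeDimOne) : Theses.LeeYangFibres.AbsoluteUpgrade :=
  fun hR => stub_amplificationHighMass hUSM hCF hR hH

end Summit.Parity.GeneralizedHardyLittlewood.Cruxes.AbsoluteUpgrade.UniformAmplification

end
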